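import Summits.Ventures.LatticeQCDFlow.Exactness.IMHAnyStartMSE
import Summits.Ventures.LatticeQCDFlow.Exactness.IMHColdStartSampleVariance
import Summits.Ventures.LatticeQCDFlow.Exactness.IMHAnyStartBurnIn
import HarnessLib

/-!
# Every start: the sample variance and the naive error bar of a flow-MCMC run from EVERY initial law —
# `E_{μ₀}[v̂_{N,b}] − E_π[v̂_N] ∈ r^b·[−E_π v̂_N, (c − a)² − E_π v̂_N]`, and the i.i.d. error bar `v̂/(N − 1)` underestimates
# the true mean-square error from every start up to `r^b·(c − a)²/(N − 1)`

HONEST FRAMING: exact (Metropolis-corrected) sampling algorithms for lattice gauge theory;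
figures of merit are autocorrelation/cost numbers at stated couplings and volumes; no
continuum-physics claim.

Venture `LatticeQCDFlow` (cell pub-lqcd), topic `Exactness`; FANOUT row 30 (lean-1, GEN-35).  NEW WORK of the
cell, general state space.  `K = indepMH q w` (normalised weight `w` maximal at `x₀`, `W = w(x₀)`, `r = 1 − 1/W`);
`a ≤ f ≤ c` measurable, `V = Var_π f`; the (biased, `1/N`) SAMPLE VARIANCE of a window of the run,
`v̂_{N,b}(x) = (1/N)·Σ_{i<N} (f(x_{b+i}) − A_{N,b}(x))²`, is what a seat prints as the spread of its measurements and,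
divided by `N − 1`, as the naive (i.i.d.) squared error bar.  GEN-33 computed `E_π[v̂_N] = V − MSE_π(N) ∈
[V(1 − (2W − 1)/N), V(1 − 1/N)]` and the cold start's `E_{x₀}[v̂_N]` exactly (`Exactness/IMHColdStartSampleVariance`).
From every start, through GEN-34's path split:

* §1 bookkeeping: `0 ≤ v̂_{N,b} ≤ (c − a)²` pointwise (**`sampleVariance_window_mem_Icc`**) and measurability.
* §2 **`imh_chain_sampleVariance_anyStart_mem_Icc`** — for every initial law `μ₀`, every `b`, `N ≥ 1`:
  `E_{μ₀}[v̂_{N,b}] − E_π[v̂_N] ∈ [−r^b·E_π[v̂_N], r^b·((c − a)² − E_π[v̂_N])]`, so (**`…_abs_le`**)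
  `|E_{μ₀}[v̂_{N,b}] − E_π[v̂_N]| ≤ r^b·(c − a)²`.
* §3 **`imh_chain_sampleVariance_anyStart_le`** ∕ **`…_ge`** — with GEN-33's equilibrium brackets:
  `(1 − r^b)·V·(1 − (2W − 1)/N) ≤ E_{μ₀}[v̂_{N,b}] ≤ (1 − r^b)·V·(1 − 1/N) + r^b·(c − a)²`.
* §4 **`imh_chain_naiveErrorBar_anyStart_le`** — THE NAIVE ERROR BAR IS OPTIMISTIC FROM EVERY START (`N ≥ 2`):
  `E_{μ₀}[v̂_{N,b}]/(N − 1) ≤ (1 − r^b)·V/N + r^b·(c − a)²/(N − 1) ≤ MSE_{μ₀}(N; b) + r^b·(c − a)²/(N − 1)` — whatever the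
  start, the expected i.i.d. squared error bar exceeds the true mean-square error of the window average by at most
  the start-up term `r^b·(c − a)²/(N − 1)`; at equilibrium (`b → ∞`) it never exceeds it (GEN-33).

Reading (gauge files `Scaling/AutoregressiveGauge…AnyStartSampleVariance`): the printed spread of `N` measurements of
an exact gauge sampler started anywhere, after `b` discards, is within `(1 − A)^b·(c − a)²` of its equilibrium mean,
and the naive error bar it yields under-covers from every start up to `(1 − A)^b·(c − a)²/(N − 1)`.
NOT CLAIMED: the variance of `v̂`; Bessel-corrected or autocorrelation-corrected estimators (GEN-33/34 files); any
number for a concrete weight.  No `sorry`, no new definitions, nothing cited as a fact.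
-/

noncomputable section

namespace Summit.Ventures.LatticeQCDFlow.Exactness

open MeasureTheory ProbabilityTheory Function Finset
open scoped ENNReal
open Summit.Ventures.LatticeQCDFlow.Scoring

variable {Ω : Type*} [MeasurableSpace Ω] {q : Measure Ω} [IsProbabilityMeasure q] {w : Ω → ℝ}

/-! ## §1 Bookkeeping: the window sample variance is a bounded measurable path statistic -/

omit [MeasurableSpace Ω] in
/-- **`0 ≤ v̂_{N,b} ≤ (c − a)²`** for `a ≤ f ≤ c`, `N ≥ 1`. [ours, bookkeeping] -/
theorem sampleVariance_window_mem_Icc {f : Ω → ℝ} {a c : ℝ} (ha : ∀ x, a ≤ f x) (hc : ∀ x, f x ≤ c) {N : ℕ}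
    (hN : N ≠ 0) (x : ℕ → Ω) (b : ℕ) :
    (∑ i ∈ range N, (f (x (b + i)) - (∑ j ∈ range N, f (x (b + j))) / N) ^ 2) / N ∈ Set.Icc 0 ((c - a) ^ 2) := by
  have hNpos : (0 : ℝ) < N := by exact_mod_cast Nat.pos_of_ne_zero hN
  obtain ⟨hA1, hA2⟩ := timeAverage_mem_Icc ha hc hN x b
  refine ⟨div_nonneg (sum_nonneg fun i _ => sq_nonneg _) hNpos.le, ?_⟩
  rw [div_le_iff₀ hNpos]
  have hterm : ∀ i ∈ range N, (f (x (b + i)) - (∑ j ∈ range N, f (x (b + j))) / N) ^ 2 ≤ (c - a) ^ 2 := by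
    intro i _
    rw [← sq_abs]
    refine pow_le_pow_left₀ (abs_nonneg _) (abs_le.2 ⟨?_, ?_⟩) 2
    · linarith [ha (x (b + i))]
    · linarith [hc (x (b + i))]
  calc ∑ i ∈ range N, (f (x (b + i)) - (∑ j ∈ range N, f (x (b + j))) / N) ^ 2
      ≤ ∑ i ∈ range N, (c - a) ^ 2 := sum_le_sum hterm
    _ = (c - a) ^ 2 * N := by rw [sum_const, card_range, nsmul_eq_mul, mul_comm]

/-- The window sample variance is measurable on path space. [ours, bookkeeping] -/
theorem measurable_sampleVariance {f : Ω → ℝ} (hf : Measurable f) (N : ℕ) :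
    Measurable fun x : ℕ → Ω => (∑ i ∈ range N, (f (x i) - (∑ j ∈ range N, f (x j)) / N) ^ 2) / N := by
  refine (Finset.measurable_sum _ fun i _ => ?_).div_const _
  exact ((hf.comp (measurable_pi_apply i)).sub
    ((Finset.measurable_sum _ fun j _ => hf.comp (measurable_pi_apply j)).div_const _)).pow_const 2

/-! ## §2 The expected sample variance from every start -/

/-- **THE SAMPLE VARIANCE FROM EVERY START**: `w` measurable (a `Fact`), positive, normalised, maximal at `x₀`;
`r = 1 − 1/w(x₀)`; `a ≤ f ≤ c` measurable; `N ≥ 1`.  For every initial law `μ₀` and every `b`: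
`E_{μ₀}[v̂_{N,b}] − E_π[v̂_N] ∈ [−r^b·E_π[v̂_N], r^b·((c − a)² − E_π[v̂_N])]`. [ours] -/
theorem imh_chain_sampleVariance_anyStart_mem_Icc [Fact (Measurable w)] (hw0 : ∀ y, 0 < w y) {x₀ : Ω}
    (hmax : ∀ y, w y ≤ w x₀) [IsProbabilityMeasure (q.withDensity fun y => ENNReal.ofReal (w y))]
    (μ₀ : Measure Ω) [IsProbabilityMeasure μ₀] {f : Ω → ℝ} (hf : Measurable f) {a c : ℝ}
    (ha : ∀ x, a ≤ f x) (hc : ∀ x, f x ≤ c) (b : ℕ) {N : ℕ} (hN : N ≠ 0) :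
    ∫ x, (∑ i ∈ range N, (f (x (b + i)) - (∑ j ∈ range N, f (x (b + j))) / N) ^ 2) / N
        ∂(Kernel.trajMeasure (X := fun _ : ℕ => Ω) μ₀
          (fun n : ℕ => (indepMH q w).comap (fun h : (i : ↥(Finset.Iic n)) → Ω => h ⟨n, Finset.mem_Iic.2 le_rfl⟩)
            (measurable_pi_apply _))) -
      ∫ x, (∑ i ∈ range N, (f (x i) - (∑ j ∈ range N, f (x j)) / N) ^ 2) / N
        ∂(Kernel.trajMeasure (X := fun _ : ℕ => Ω) (q.withDensity fun y => ENNReal.ofReal (w y))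
          (fun n : ℕ => (indepMH q w).comap (fun h : (i : ↥(Finset.Iic n)) → Ω => h ⟨n, Finset.mem_Iic.2 le_rfl⟩)
            (measurable_pi_apply _))) ∈
      Set.Icc
        (-((1 - (w x₀)⁻¹) ^ b *
          ∫ x, (∑ i ∈ range N, (f (x i) - (∑ j ∈ range N, f (x j)) / N) ^ 2) / N
            ∂(Kernel.trajMeasure (X := fun _ : ℕ => Ω) (q.withDensity fun y => ENNReal.ofReal (w y))
              (fun n : ℕ => (indepMH q w).comap (fun h : (i : ↥(Finset.Iic n)) → Ω => h ⟨n, Finset.mem_Iic.2 le_rfl⟩)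
                (measurable_pi_apply _)))))
        ((1 - (w x₀)⁻¹) ^ b * ((c - a) ^ 2 -
          ∫ x, (∑ i ∈ range N, (f (x i) - (∑ j ∈ range N, f (x j)) / N) ^ 2) / N
            ∂(Kernel.trajMeasure (X := fun _ : ℕ => Ω) (q.withDensity fun y => ENNReal.ofReal (w y))
              (fun n : ℕ => (indepMH q w).comap (fun h : (i : ↥(Finset.Iic n)) → Ω => h ⟨n, Finset.mem_Iic.2 le_rfl⟩)
                (measurable_pi_apply _))))) := by
  have h := imh_chain_shift_integral_anyStart_mem_Icc (q := q) hw0 hmax μ₀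
    (F := fun x : ℕ → Ω => (∑ i ∈ range N, (f (x i) - (∑ j ∈ range N, f (x j)) / N) ^ 2) / N)
    (measurable_sampleVariance hf N) (a := 0) (c := (c - a) ^ 2)
    (fun x => by simpa using (sampleVariance_window_mem_Icc ha hc hN x 0).1)
    (fun x => by simpa using (sampleVariance_window_mem_Icc ha hc hN x 0).2) b
  simp only [zero_sub] at h
  simpa [neg_mul, mul_neg] using h

/-- **`|E_{μ₀}[v̂_{N,b}] − E_π[v̂_N]| ≤ r^b·(c − a)²`** from every start. [ours] -/
theorem imh_chain_sampleVariance_anyStart_abs_le [Fact (Measurable w)] (hw0 : ∀ y, 0 < w y) {x₀ : Ω}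
    (hmax : ∀ y, w y ≤ w x₀) [IsProbabilityMeasure (q.withDensity fun y => ENNReal.ofReal (w y))]
    (μ₀ : Measure Ω) [IsProbabilityMeasure μ₀] {f : Ω → ℝ} (hf : Measurable f) {a c : ℝ}
    (ha : ∀ x, a ≤ f x) (hc : ∀ x, f x ≤ c) (b : ℕ) {N : ℕ} (hN : N ≠ 0) :
    |∫ x, (∑ i ∈ range N, (f (x (b + i)) - (∑ j ∈ range N, f (x (b + j))) / N) ^ 2) / N
        ∂(Kernel.trajMeasure (X := fun _ : ℕ => Ω) μ₀
          (fun n : ℕ => (indepMH q w).comap (fun h : (i : ↥(Finset.Iic n)) → Ω => h ⟨n, Finset.mem_Iic.2 le_rfl⟩)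
            (measurable_pi_apply _))) -
      ∫ x, (∑ i ∈ range N, (f (x i) - (∑ j ∈ range N, f (x j)) / N) ^ 2) / N
        ∂(Kernel.trajMeasure (X := fun _ : ℕ => Ω) (q.withDensity fun y => ENNReal.ofReal (w y))
          (fun n : ℕ => (indepMH q w).comap (fun h : (i : ↥(Finset.Iic n)) → Ω => h ⟨n, Finset.mem_Iic.2 le_rfl⟩)
            (measurable_pi_apply _)))| ≤ (1 - (w x₀)⁻¹) ^ b * (c - a) ^ 2 := by
  obtain ⟨h1, h2⟩ := imh_chain_sampleVariance_anyStart_mem_Icc (q := q) hw0 hmax μ₀ hf ha hc b hN (x₀ := x₀)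
  set Pπ := Kernel.trajMeasure (X := fun _ : ℕ => Ω) (q.withDensity fun y => ENNReal.ofReal (w y))
    (fun n : ℕ => (indepMH q w).comap (fun h : (i : ↥(Finset.Iic n)) → Ω => h ⟨n, Finset.mem_Iic.2 le_rfl⟩)
      (measurable_pi_apply _)) with hPπ
  obtain ⟨hE0, hE1⟩ := integral_mem_Icc_of_bounds Pπ (measurable_sampleVariance hf N) (a := 0) (c := (c - a) ^ 2)
    (fun x => by simpa using (sampleVariance_window_mem_Icc ha hc hN x 0).1)
    (fun x => by simpa using (sampleVariance_window_mem_Icc ha hc hN x 0).2)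
  have hW : 1 ≤ w x₀ := one_le_of_mode (q := q) hmax
  have hr0 : 0 ≤ (1 - (w x₀)⁻¹) ^ b := pow_nonneg (sub_nonneg.2 (inv_le_one_of_one_le₀ hW)) b
  rw [abs_le]
  constructor <;> nlinarith

/-! ## §3 With the equilibrium brackets of GEN-33 -/

/-- **`E_{μ₀}[v̂_{N,b}] ≤ (1 − r^b)·V·(1 − 1/N) + r^b·(c − a)²`** from every start (`N ≥ 1`). [ours] -/
theorem imh_chain_sampleVariance_anyStart_le [Fact (Measurable w)] (hw0 : ∀ y, 0 < w y) {x₀ : Ω}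
    (hmax : ∀ y, w y ≤ w x₀) [IsProbabilityMeasure (q.withDensity fun y => ENNReal.ofReal (w y))]
    (μ₀ : Measure Ω) [IsProbabilityMeasure μ₀] {f : Ω → ℝ} (hf : Measurable f) {a c : ℝ}
    (ha : ∀ x, a ≤ f x) (hc : ∀ x, f x ≤ c) (b : ℕ) {N : ℕ} (hN : N ≠ 0) :
    ∫ x, (∑ i ∈ range N, (f (x (b + i)) - (∑ j ∈ range N, f (x (b + j))) / N) ^ 2) / N
        ∂(Kernel.trajMeasure (X := fun _ : ℕ => Ω) μ₀
          (fun n : ℕ => (indepMH q w).comap (fun h : (i : ↥(Finset.Iic n)) → Ω => h ⟨n, Finset.mem_Iic.2 le_rfl⟩)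
            (measurable_pi_apply _))) ≤
      (1 - (1 - (w x₀)⁻¹) ^ b) *
          ((∫ x, (f x - ∫ z, f z ∂(q.withDensity fun y => ENNReal.ofReal (w y))) ^ 2
            ∂(q.withDensity fun y => ENNReal.ofReal (w y))) * (1 - 1 / N)) +
        (1 - (w x₀)⁻¹) ^ b * (c - a) ^ 2 := by
  obtain ⟨-, h2⟩ := imh_chain_sampleVariance_anyStart_mem_Icc (q := q) hw0 hmax μ₀ hf ha hc b hN (x₀ := x₀)
  have hC : ∀ x, |f x| ≤ max |a| |c| := fun x => abs_le_max_abs_abs (ha x) (hc x)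
  obtain ⟨-, hup⟩ := imh_chain_sampleVariance_stationary_two_sided (q := q) hw0 hmax hf hC hN (x₀ := x₀)
  have hW : 1 ≤ w x₀ := one_le_of_mode (q := q) hmax
  have hr : 0 ≤ 1 - (w x₀)⁻¹ := sub_nonneg.2 (inv_le_one_of_one_le₀ hW)
  have hc0 : 0 ≤ 1 - (1 - (w x₀)⁻¹) ^ b := sub_nonneg.2 (pow_le_one₀ hr (sub_le_self _ (inv_nonneg.mpr (hw0 x₀).le)))
  nlinarith [mul_le_mul_of_nonneg_left hup hc0]

/-- **`E_{μ₀}[v̂_{N,b}] ≥ (1 − r^b)·V·(1 − (2W − 1)/N)`** from every start (`N ≥ 1`). [ours] -/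
theorem imh_chain_sampleVariance_anyStart_ge [Fact (Measurable w)] (hw0 : ∀ y, 0 < w y) {x₀ : Ω}
    (hmax : ∀ y, w y ≤ w x₀) [IsProbabilityMeasure (q.withDensity fun y => ENNReal.ofReal (w y))]
    (μ₀ : Measure Ω) [IsProbabilityMeasure μ₀] {f : Ω → ℝ} (hf : Measurable f) {a c : ℝ}
    (ha : ∀ x, a ≤ f x) (hc : ∀ x, f x ≤ c) (b : ℕ) {N : ℕ} (hN : N ≠ 0) :
    (1 - (1 - (w x₀)⁻¹) ^ b) *
        ((∫ x, (f x - ∫ z, f z ∂(q.withDensity fun y => ENNReal.ofReal (w y))) ^ 2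
          ∂(q.withDensity fun y => ENNReal.ofReal (w y))) * (1 - (2 * w x₀ - 1) / N)) ≤
      ∫ x, (∑ i ∈ range N, (f (x (b + i)) - (∑ j ∈ range N, f (x (b + j))) / N) ^ 2) / N
        ∂(Kernel.trajMeasure (X := fun _ : ℕ => Ω) μ₀
          (fun n : ℕ => (indepMH q w).comap (fun h : (i : ↥(Finset.Iic n)) → Ω => h ⟨n, Finset.mem_Iic.2 le_rfl⟩)
            (measurable_pi_apply _))) := by
  obtain ⟨h1, -⟩ := imh_chain_sampleVariance_anyStart_mem_Icc (q := q) hw0 hmax μ₀ hf ha hc b hN (x₀ := x₀)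
  have hC : ∀ x, |f x| ≤ max |a| |c| := fun x => abs_le_max_abs_abs (ha x) (hc x)
  obtain ⟨hlo, -⟩ := imh_chain_sampleVariance_stationary_two_sided (q := q) hw0 hmax hf hC hN (x₀ := x₀)
  have hW : 1 ≤ w x₀ := one_le_of_mode (q := q) hmax
  have hr : 0 ≤ 1 - (w x₀)⁻¹ := sub_nonneg.2 (inv_le_one_of_one_le₀ hW)
  have hc0 : 0 ≤ 1 - (1 - (w x₀)⁻¹) ^ b := sub_nonneg.2 (pow_le_one₀ hr (sub_le_self _ (inv_nonneg.mpr (hw0 x₀).le)))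
  nlinarith [mul_le_mul_of_nonneg_left hlo hc0]

/-! ## §4 The naive error bar is optimistic from every start -/

/-- **THE NAIVE ERROR BAR FROM EVERY START** (`N ≥ 2`): `E_{μ₀}[v̂_{N,b}]/(N − 1) ≤ (1 − r^b)·V/N + r^b·(c − a)²/(N − 1)`
and `(1 − r^b)·V/N ≤ MSE_{μ₀}(N; b)`: the expected i.i.d. squared error bar exceeds the true mean-square error of the
window average by at most `r^b·(c − a)²/(N − 1)`, whatever the start. [ours] -/
theorem imh_chain_naiveErrorBar_anyStart_le [Fact (Measurable w)] (hw0 : ∀ y, 0 < w y) {x₀ : Ω}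
    (hmax : ∀ y, w y ≤ w x₀) [IsProbabilityMeasure (q.withDensity fun y => ENNReal.ofReal (w y))]
    (μ₀ : Measure Ω) [IsProbabilityMeasure μ₀] {f : Ω → ℝ} (hf : Measurable f) {a c : ℝ}
    (ha : ∀ x, a ≤ f x) (hc : ∀ x, f x ≤ c) (b : ℕ) {N : ℕ} (hN : 2 ≤ N) :
    (∫ x, (∑ i ∈ range N, (f (x (b + i)) - (∑ j ∈ range N, f (x (b + j))) / N) ^ 2) / N
        ∂(Kernel.trajMeasure (X := fun _ : ℕ => Ω) μ₀
          (fun n : ℕ => (indepMH q w).comap (fun h : (i : ↥(Finset.Iic n)) → Ω => h ⟨n, Finset.mem_Iic.2 le_rfl⟩)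
            (measurable_pi_apply _)))) / (N - 1) ≤
      (1 - (1 - (w x₀)⁻¹) ^ b) *
          (∫ x, (f x - ∫ z, f z ∂(q.withDensity fun y => ENNReal.ofReal (w y))) ^ 2
            ∂(q.withDensity fun y => ENNReal.ofReal (w y))) / N +
        (1 - (w x₀)⁻¹) ^ b * (c - a) ^ 2 / (N - 1) ∧
    (1 - (1 - (w x₀)⁻¹) ^ b) *
        (∫ x, (f x - ∫ z, f z ∂(q.withDensity fun y => ENNReal.ofReal (w y))) ^ 2
          ∂(q.withDensity fun y => ENNReal.ofReal (w y))) / N ≤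
      ∫ x, ((∑ i ∈ range N, f (x (b + i))) / N - ∫ z, f z ∂(q.withDensity fun y => ENNReal.ofReal (w y))) ^ 2
        ∂(Kernel.trajMeasure (X := fun _ : ℕ => Ω) μ₀
          (fun n : ℕ => (indepMH q w).comap (fun h : (i : ↥(Finset.Iic n)) → Ω => h ⟨n, Finset.mem_Iic.2 le_rfl⟩)
            (measurable_pi_apply _))) := by
  have hN0 : N ≠ 0 := by omega
  have hNr : (2 : ℝ) ≤ N := by exact_mod_cast hN
  have hN1 : (0 : ℝ) < N - 1 := by linarith
  have hNpos : (0 : ℝ) < N := by linarith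
  have hC : ∀ x, |f x| ≤ max |a| |c| := fun x => abs_le_max_abs_abs (ha x) (hc x)
  have hup := imh_chain_sampleVariance_anyStart_le (q := q) hw0 hmax μ₀ hf ha hc b hN0 (x₀ := x₀)
  have hge := imh_chain_windowMSE_anyStart_ge (q := q) hw0 hmax μ₀ hf ha hc b hN0 (x₀ := x₀)
  have hstat := imh_chain_mse_stationary_ge (q := q) hw0 hmax hf hC hN0 (x₀ := x₀)
  set V := ∫ x, (f x - ∫ z, f z ∂(q.withDensity fun y => ENNReal.ofReal (w y))) ^ 2
    ∂(q.withDensity fun y => ENNReal.ofReal (w y)) with hV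
  have hV0 : 0 ≤ V := integral_nonneg fun x => sq_nonneg _
  have hW : 1 ≤ w x₀ := one_le_of_mode (q := q) hmax
  have hr : 0 ≤ 1 - (w x₀)⁻¹ := sub_nonneg.2 (inv_le_one_of_one_le₀ hW)
  have hrb : 0 ≤ (1 - (w x₀)⁻¹) ^ b := pow_nonneg hr b
  have hc0 : 0 ≤ 1 - (1 - (w x₀)⁻¹) ^ b := sub_nonneg.2 (pow_le_one₀ hr (sub_le_self _ (inv_nonneg.mpr (hw0 x₀).le)))
  refine ⟨?_, ?_⟩
  swap
  · rw [mul_div_assoc]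
    exact (mul_le_mul_of_nonneg_left hstat hc0).trans hge
  rw [div_le_iff₀ hN1]
  have e1 : ((1 - (1 - (w x₀)⁻¹) ^ b) * V / N + (1 - (w x₀)⁻¹) ^ b * (c - a) ^ 2 / (N - 1)) * (N - 1) =
      (1 - (1 - (w x₀)⁻¹) ^ b) * (V * ((N - 1) / N)) + (1 - (w x₀)⁻¹) ^ b * (c - a) ^ 2 := by
    field_simp
  have e2 : V * (1 - 1 / (N : ℝ)) = V * ((N - 1) / N) := by
    congr 1
    field_simp
  rw [e1, ← e2]
  exact hup

end Summit.Ventures.LatticeQCDFlow.Exactness
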